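import Summits.QuantumFields.YangMills.Theorems.BalabanLadderUVSeamRecFloorsOfTwoPoint
import Summits.QuantumFields.YangMills.Theorems.BalabanLadderUVSeamRecCeilingsTransfer
import Summits.QuantumFields.YangMills.Theorems.LangevinControlUVOSLegsFromFemtoAndGapStubCollar6
import Summits.QuantumFields.YangMills.Theses.BalabanLadder
import HarnessLib

/-!
# Crux `UVSeamRec` (stmt-QuantumFields-20043): the WHOLE seam from NT's femto line — `UV` idle on this path

Helper file (`--supports stmt-QuantumFields-20043`) of the lead prover (unit `ym-spine-20043-p1`), landing the owner's
kernel-checked remark (ym-beyond-p2 g20, `p2-g20-files/UVSeamRec_of_femto_check.lean` 58c3abd130baf1b4, ruling 2026-08-26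
12:26Z (2)) in tree form, with the commensurable (ω) variant added.

On the FEMTO discharge path both legs of the seam body come from the same data: `Statement.stub_fcp6` (19353's registered
engine stub) gives `FBL6 ∧ FC2 ∧ FC3` at the femto unit `a`; the landed collar transfer `stub_collar6` (`FBL6 ⇒ MomentBounds6`)
gives the plane-resolved CEILINGS at `a`, moved one-sidedly to `uRec` by `CeilingsTransfer.momentBounds6_of_eventually_le`
(`a ≤ c·uRec` eventually); the FLOORS at `uRec` come from `FloorsC` / `WindowFloors` (compact bump floors by the re-run
`stub_lower`, then the unit transfer).  Hence:

* `uvSeamRecBody_of_femto` — `IsCompactSimpleLieGroup SU(2)`, `Statement.stub_fcp6`, ONE representation with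
  `TwoPointPinned ∧ Skewness` at a unit `a` with `a/uRec → c₀ > 0` ⇒ `∃ r, LowerBounds SU(2) r uRec ∧ MomentBounds6 SU(2) r uRec`;
* `uvSeamRecBody_of_femtoCommensurable` — the same with only `c₁ ≤ a/uRec ≤ c₂` eventually (window floors; no convergence);
* `uvSeamRec_of_femto`, `uvSeamRec_of_femtoCommensurable` — the route decl `…Theses.BalabanLadder.UVSeamRec` with its `UV`
  hypothesis UNUSED (D0 transport `Transport.stub_transport_proved`).  `IsCompactSimpleLieGroup SU(2)` is carried as a
  hypothesis; inside any `UVSeamRec_of` it is `SimpleTransport.isCompactSimpleLieGroup_su2_of_equiv hne.some hG` (landed,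
  p442480 — not imported here only because its farm olean was still unbuilt when this file was checked).

Reading (owner's consumes-ledger, LINE №57): `UV`/E0′ is load-bearing for the seam exactly on the NON-femto floors path
(Track-A N32′); on the femto path 19353's two stubs at SU(2) + F-C close the whole seam.  The registered v3 cut
{`stub_ceilings`, `stub_floorsEngine`} keeps both paths open.
-/

set_option autoImplicit false

noncomputable section

open MeasureTheory Filter Topology
open Literature.MathematicalPhysics.QuantumFieldTheory Literature.MathematicalPhysics.QuantumLattice
open Summit.QuantumFields.YangMills.Cruxes.OSLegsFromFemtoAndGap.DlrCollarTransfer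

namespace Summit.QuantumFields.YangMills.Cruxes.UVSeamRec.SeamOfFemto

variable {G : Type} [Group G] [TopologicalSpace G] [IsTopologicalGroup G] [CompactSpace G]
  [MeasurableSpace G] [BorelSpace G]

/-- **Ceilings at the unit of record on the femto path** (generic `G`): `stub_fcp6`'s `FBL6` at the femto unit `a`, the landed
collar transfer `stub_collar6`, and `a ≤ c · uRec` eventually. [folklore] -/
theorem momentBounds6_uRec_of_femto (hG : IsCompactSimpleLieGroup G) (hfcp : Statement.stub_fcp6) (r : LatticeRep G)
    {a : ℝ → ℝ} {c : ℝ} (hc : 0 < c) (hle : ∀ᶠ β in atTop, a β ≤ c * Transport.uRec β)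
    (hTP : TwoPointPinned G r a) (hSk : Skewness G r a) : MomentBounds6 G r Transport.uRec := by
  obtain ⟨hFBL6, -, -⟩ := hfcp G hG r a hTP hSk
  exact CeilingsTransfer.momentBounds6_of_eventually_le r hc hle (stub_collar6 G r a hFBL6)

/-- **The seam body on the femto path, convergence form** (`SU(2)`, Borel): floors ∧ plane-resolved ceilings at `uRec` for the
femto witness `r`, from `IsCompactSimpleLieGroup SU(2)`, `Statement.stub_fcp6` and ONE representation with
`TwoPointPinned ∧ Skewness` at a unit `a` with `a β / uRec β → c₀ > 0`. (= the owner's `uvSeamRecBody_of_femto`.) [folklore] -/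
theorem uvSeamRecBody_of_femto (hSU2 : IsCompactSimpleLieGroup (Matrix.specialUnitaryGroup (Fin 2) ℂ))
    (hfcp : Statement.stub_fcp6)
    (heng : letI : MeasurableSpace (Matrix.specialUnitaryGroup (Fin 2) ℂ) := borel _
      haveI : BorelSpace (Matrix.specialUnitaryGroup (Fin 2) ℂ) := ⟨rfl⟩
      ∃ (r : LatticeRep (Matrix.specialUnitaryGroup (Fin 2) ℂ)) (a : ℝ → ℝ) (c₀ : ℝ), 0 < c₀ ∧
        Tendsto (fun β => a β / Transport.uRec β) atTop (𝓝 c₀) ∧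
        TwoPointPinned (Matrix.specialUnitaryGroup (Fin 2) ℂ) r a ∧ Skewness (Matrix.specialUnitaryGroup (Fin 2) ℂ) r a) :
    letI : MeasurableSpace (Matrix.specialUnitaryGroup (Fin 2) ℂ) := borel _
    haveI : BorelSpace (Matrix.specialUnitaryGroup (Fin 2) ℂ) := ⟨rfl⟩
    ∃ r : LatticeRep (Matrix.specialUnitaryGroup (Fin 2) ℂ),
      LowerBounds (Matrix.specialUnitaryGroup (Fin 2) ℂ) r Transport.uRec ∧
        MomentBounds6 (Matrix.specialUnitaryGroup (Fin 2) ℂ) r Transport.uRec := by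
  letI : MeasurableSpace (Matrix.specialUnitaryGroup (Fin 2) ℂ) := borel _
  haveI : BorelSpace (Matrix.specialUnitaryGroup (Fin 2) ℂ) := ⟨rfl⟩
  obtain ⟨r, a, c₀, hc₀, hau, hTP, hSk⟩ := heng
  have hMBu : MomentBounds6 (Matrix.specialUnitaryGroup (Fin 2) ℂ) r Transport.uRec :=
    momentBounds6_uRec_of_femto hSU2 hfcp r (by positivity : (0 : ℝ) < 2 * c₀)
      (CeilingsTransfer.eventually_le_of_tendsto_div hc₀ UnitTransfer.uRec_pos hau) hTP hSk
  exact ⟨r, FloorsC.lowerBounds_uRec_of_femtoEngine _ r a hSU2 hfcp hc₀ hau hTP hSk hMBu, hMBu⟩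

/-- **The seam body on the femto path, commensurable form** (`SU(2)`, Borel): the same with only
`c₁ ≤ a β / uRec β ≤ c₂` eventually (`0 < c₁ ≤ c₂`) — floors by the scale-window route (`WindowFloors`), ceilings one-sided;
no convergence of the unit ratio is used. [folklore] -/
theorem uvSeamRecBody_of_femtoCommensurable (hSU2 : IsCompactSimpleLieGroup (Matrix.specialUnitaryGroup (Fin 2) ℂ))
    (hfcp : Statement.stub_fcp6)
    (heng : letI : MeasurableSpace (Matrix.specialUnitaryGroup (Fin 2) ℂ) := borel _
      haveI : BorelSpace (Matrix.specialUnitaryGroup (Fin 2) ℂ) := ⟨rfl⟩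
      ∃ (r : LatticeRep (Matrix.specialUnitaryGroup (Fin 2) ℂ)) (a : ℝ → ℝ) (c₁ c₂ : ℝ), 0 < c₁ ∧ c₁ ≤ c₂ ∧
        (∀ᶠ β in atTop, c₁ ≤ a β / Transport.uRec β ∧ a β / Transport.uRec β ≤ c₂) ∧
        TwoPointPinned (Matrix.specialUnitaryGroup (Fin 2) ℂ) r a ∧ Skewness (Matrix.specialUnitaryGroup (Fin 2) ℂ) r a) :
    letI : MeasurableSpace (Matrix.specialUnitaryGroup (Fin 2) ℂ) := borel _
    haveI : BorelSpace (Matrix.specialUnitaryGroup (Fin 2) ℂ) := ⟨rfl⟩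
    ∃ r : LatticeRep (Matrix.specialUnitaryGroup (Fin 2) ℂ),
      LowerBounds (Matrix.specialUnitaryGroup (Fin 2) ℂ) r Transport.uRec ∧
        MomentBounds6 (Matrix.specialUnitaryGroup (Fin 2) ℂ) r Transport.uRec := by
  letI : MeasurableSpace (Matrix.specialUnitaryGroup (Fin 2) ℂ) := borel _
  haveI : BorelSpace (Matrix.specialUnitaryGroup (Fin 2) ℂ) := ⟨rfl⟩
  obtain ⟨r, a, c₁, c₂, hc₁, hc₁₂, hwin, hTP, hSk⟩ := heng
  have hc₂ : 0 < c₂ := hc₁.trans_le hc₁₂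
  have hle : ∀ᶠ β in atTop, a β ≤ c₂ * Transport.uRec β := by
    filter_upwards [hwin] with β hβ
    exact (div_le_iff₀ (UnitTransfer.uRec_pos β)).1 hβ.2
  have hMBu : MomentBounds6 (Matrix.specialUnitaryGroup (Fin 2) ℂ) r Transport.uRec :=
    momentBounds6_uRec_of_femto hSU2 hfcp r hc₂ hle hTP hSk
  exact ⟨r, WindowFloors.lowerBounds_uRec_of_femtoCommensurable _ r a hSU2 hfcp hc₁ hc₁₂ hwin hTP hSk, hMBu⟩

/-- **`UVSeamRec` from NT's femto line at SU(2), convergence form — `UV` UNUSED.**  `Statement.stub_fcp6` and ONE lattice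
representation of `SU(2)` with `TwoPointPinned ∧ Skewness` at a unit `a` with `a/uRec → c₀ > 0` give the route decl; the
`UV` hypothesis is discarded (`IsCompactSimpleLieGroup SU(2)` carried; see the module docstring). [folklore] -/
theorem uvSeamRec_of_femto (hSU2 : IsCompactSimpleLieGroup (Matrix.specialUnitaryGroup (Fin 2) ℂ))
    (hfcp : Statement.stub_fcp6)
    (heng : letI : MeasurableSpace (Matrix.specialUnitaryGroup (Fin 2) ℂ) := borel _
      haveI : BorelSpace (Matrix.specialUnitaryGroup (Fin 2) ℂ) := ⟨rfl⟩
      ∃ (r : LatticeRep (Matrix.specialUnitaryGroup (Fin 2) ℂ)) (a : ℝ → ℝ) (c₀ : ℝ), 0 < c₀ ∧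
        Tendsto (fun β => a β / Transport.uRec β) atTop (𝓝 c₀) ∧
        TwoPointPinned (Matrix.specialUnitaryGroup (Fin 2) ℂ) r a ∧ Skewness (Matrix.specialUnitaryGroup (Fin 2) ℂ) r a) :
    Summit.QuantumFields.YangMills.Theses.BalabanLadder.UVSeamRec := by
  intro _hUV G _ _ _ _ hG hne
  exact Transport.stub_transport_proved (uvSeamRecBody_of_femto hSU2 hfcp heng) G hG hne

/-- **`UVSeamRec` from NT's femto line at SU(2), commensurable form — `UV` UNUSED**, no convergence of the unit ratio. [folklore] -/
theorem uvSeamRec_of_femtoCommensurable (hSU2 : IsCompactSimpleLieGroup (Matrix.specialUnitaryGroup (Fin 2) ℂ))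
    (hfcp : Statement.stub_fcp6)
    (heng : letI : MeasurableSpace (Matrix.specialUnitaryGroup (Fin 2) ℂ) := borel _
      haveI : BorelSpace (Matrix.specialUnitaryGroup (Fin 2) ℂ) := ⟨rfl⟩
      ∃ (r : LatticeRep (Matrix.specialUnitaryGroup (Fin 2) ℂ)) (a : ℝ → ℝ) (c₁ c₂ : ℝ), 0 < c₁ ∧ c₁ ≤ c₂ ∧
        (∀ᶠ β in atTop, c₁ ≤ a β / Transport.uRec β ∧ a β / Transport.uRec β ≤ c₂) ∧
        TwoPointPinned (Matrix.specialUnitaryGroup (Fin 2) ℂ) r a ∧ Skewness (Matrix.specialUnitaryGroup (Fin 2) ℂ) r a) :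
    Summit.QuantumFields.YangMills.Theses.BalabanLadder.UVSeamRec := by
  intro _hUV G _ _ _ _ hG hne
  exact Transport.stub_transport_proved (uvSeamRecBody_of_femtoCommensurable hSU2 hfcp heng) G hG hne

end Summit.QuantumFields.YangMills.Cruxes.UVSeamRec.SeamOfFemto

end
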